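import Summits.AtomisticToContinuum.BoseEinsteinCondensation.Theorems.BECGroundStateSOSPeriodicIRBoundFsumConeCS
import Summits.AtomisticToContinuum.BoseEinsteinCondensation.Theorems.BECGroundStateSOSPeriodicIRBoundFsumConeMultiplier
import Summits.AtomisticToContinuum.BoseEinsteinCondensation.Theorems.BECGroundStateSOSPeriodicIRBoundFsumConeIBP
import Summits.AtomisticToContinuum.BoseEinsteinCondensation.Theorems.BECGroundStateSOSPeriodicIRBoundFsumConePhaseUp
import HarnessLib

/-!
# Crux `PeriodicIRBound` (stmt-AtomisticToContinuum-3972), line `fsum-phase-pencil`, stub S2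
# `stub_phaseConeBlock : PhaseConeBlock` — the f-sum rule and the closing assembly

**Part A, the f-sum rule as a form inequality.** For a `C¹` multiplier `m` with `|∇m|² ≤ B` and a `C¹` amplitude `Ψ`,
the POINTWISE identity `|∇(mΨ)|² + |∇(m̄Ψ)|² = 2|∇m|²|Ψ|² + 2 Re ∑ conj(∂(|m|²Ψ)) ∂Ψ` integrates to
`Q_E(mΨ) + Q_E(m̄Ψ) ≤ 2B‖Ψ‖² + 2(Re B(|m|²Ψ, Ψ) − E Re⟨|m|²Ψ, Ψ⟩)` (`eform_mul_add_conj_mul_le`, the f-SUM RULE for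
`m = ρ_k†`, `|∇ρ_k†|² = N‖k̃‖²`); for a `δ`-near-minimiser the bracket is `≤ √δ √𝓔[|m|²Ψ]` (`WF.abs_formRe_sub_le`) and
`Q_{E₀}(m̄Ψ) ≥ 0` (`stub_eformNonneg`): `Q_{E₀}(mΨ) ≤ 2B‖Ψ‖² + 2√δ √𝓔[|m|²Ψ]` (`eform_mul_le_of_nearMin`).

**Part B, the assembly.** With `G = G_k = ∑ⱼ e_k(xⱼ)`, `U = U_kΨ`:
`Re⟨U, W_kΨ⟩ = [Re B(U, GΨ) − E₀Re⟨U, GΨ⟩] − [Re B(ḠU, Ψ) − E₀Re⟨ḠU, Ψ⟩]` (integration by parts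
`formRe_densityWave_mul`, `Re⟨U, GΨ⟩ = Re⟨ḠU, Ψ⟩`); the first bracket is `≤ √(Q(U) Q(GΨ))` (cone Cauchy–Schwarz
`abs_formRe_sub_le_sqrt`), the second `≤ √δ √𝓔[ḠU]` (`abs_innerRe_phaseUp_kinCommutator_le`); Part A gives
`Q(GΨ) ≤ 2N‖k̃‖² + 2√δ √𝓔[|G|²Ψ]` (`eform_densityWave_mul_le_of_nearMin`); the uniform bounds
`𝓔[ḠU], 𝓔[|G|²Ψ] ≤ C·(E₀ + 1)` over near-minimisers (`exists_bound_conj_densityWave_phaseUp`,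
`exists_bound_densityWave_sq`) fix `δ` (`exists_slack_sqrt`), and `cone_block_algebra` concludes:
`|Re⟨U_kΨ, W_kΨ⟩| ≤ √(Q_{E₀}(U_kΨ)·(2N‖k̃‖² + ε)) + ε` (`stub_phaseConeBlock`; `N = 0` is trivial, `U = 0`).
-/

noncomputable section

open MeasureTheory Filter
open scoped ENNReal NNReal ComplexConjugate BigOperators

namespace Summit.AtomisticToContinuum.BoseEinsteinCondensation.Cruxes.PeriodicIRBound.FsumPhasePencil

open Literature.MathematicalPhysics.QuantumManyBody.BoseGas
open Summit.AtomisticToContinuum.BoseEinsteinCondensation.Cruxes.PeriodicIRBound.LinearPhFloorWagner.WF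

variable {M n : ℕ} {L : ℝ}

/-! ## Pointwise identities -/

/-- The complex identity behind the f-sum rule: with `a = ∂m`, `z = m`, `p = Ψ`, `q = ∂Ψ`,
`|ap + zq|² + |āp + z̄q|² = 2|a|²|p|² + 2 Re( conj(ā(zp) + z̄(ap + zq)) q )`. [folklore] -/
theorem fsum_pointwise (a z p q : ℂ) :
    ‖a * p + z * q‖ ^ 2 + ‖conj a * p + conj z * q‖ ^ 2 =
      2 * (‖a‖ ^ 2 * ‖p‖ ^ 2) + 2 * (conj (conj a * (z * p) + conj z * (a * p + z * q)) * q).re := by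
  simp only [Complex.sq_norm, Complex.normSq_apply, Complex.mul_re, Complex.mul_im, Complex.add_re,
    Complex.add_im, Complex.conj_re, Complex.conj_im, map_add, map_mul, Complex.conj_conj]
  ring

/-- `|zp|² = Re( conj(z̄(zp)) p )`. [folklore] -/
theorem norm_mul_sq_eq_re (z p : ℂ) : ‖z * p‖ ^ 2 = (conj (conj z * (z * p)) * p).re := by
  simp only [Complex.sq_norm, Complex.normSq_apply, Complex.mul_re, Complex.mul_im, Complex.conj_re,
    Complex.conj_im, map_mul, Complex.conj_conj]
  ring

/-- `|z̄p|² = Re( conj(z̄(zp)) p )`. [folklore] -/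
theorem norm_conj_mul_sq_eq_re (z p : ℂ) : ‖conj z * p‖ ^ 2 = (conj (conj z * (z * p)) * p).re := by
  rw [← norm_mul_sq_eq_re, norm_mul, norm_mul, Complex.norm_conj]

variable {m Ψ : Config M → ℂ}

/-- **The pointwise f-sum identity**: `|∇(mΨ)|² + |∇(m̄Ψ)|² = 2|∇m|²|Ψ|² + 2 Re ∑ conj(∂(m̄ m Ψ)) ∂Ψ`
for `m, Ψ` differentiable at the point. [folklore] -/
theorem kineticDensityReal_mul_add_conj_mul {X : Config M} (hm : DifferentiableAt ℝ m X)
    (hΨ : DifferentiableAt ℝ Ψ X) :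
    kineticDensityReal (fun Y => m Y * Ψ Y) X + kineticDensityReal (fun Y => conj (m Y) * Ψ Y) X =
      2 * (kineticDensityReal m X * ‖Ψ X‖ ^ 2) +
        2 * kinCross (fun Y => conj (m Y) * (m Y * Ψ Y)) Ψ X := by
  have hmc : DifferentiableAt ℝ (fun Y => conj (m Y)) X :=
    (Complex.conjCLE.differentiable.differentiableAt).comp X hm
  have hmΨ : DifferentiableAt ℝ (fun Y => m Y * Ψ Y) X := hm.mul hΨ
  have key : ∀ (i : Fin M) (c : Fin 3),
      ‖fderiv ℝ (fun Y => m Y * Ψ Y) X (Pi.single i (EuclideanSpace.single c (1 : ℝ)))‖ ^ 2 +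
        ‖fderiv ℝ (fun Y => conj (m Y) * Ψ Y) X (Pi.single i (EuclideanSpace.single c (1 : ℝ)))‖ ^ 2 =
      2 * (‖fderiv ℝ m X (Pi.single i (EuclideanSpace.single c (1 : ℝ)))‖ ^ 2 * ‖Ψ X‖ ^ 2) +
        2 * (conj (fderiv ℝ (fun Y => conj (m Y) * (m Y * Ψ Y)) X
            (Pi.single i (EuclideanSpace.single c (1 : ℝ)))) *
          fderiv ℝ Ψ X (Pi.single i (EuclideanSpace.single c (1 : ℝ)))).re := by
    intro i c
    rw [fderiv_mul_apply hm hΨ, fderiv_mul_apply hmc hΨ, fderiv_mul_apply hmc hmΨ, fderiv_conj_apply hm,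
      fderiv_mul_apply hm hΨ]
    exact fsum_pointwise _ _ _ _
  unfold kineticDensityReal kinCross
  calc (∑ i : Fin M, ∑ c : Fin 3,
        ‖fderiv ℝ (fun Y => m Y * Ψ Y) X (Pi.single i (EuclideanSpace.single c (1 : ℝ)))‖ ^ 2) +
        ∑ i : Fin M, ∑ c : Fin 3,
          ‖fderiv ℝ (fun Y => conj (m Y) * Ψ Y) X (Pi.single i (EuclideanSpace.single c (1 : ℝ)))‖ ^ 2
      = ∑ i : Fin M, ∑ c : Fin 3,
          (‖fderiv ℝ (fun Y => m Y * Ψ Y) X (Pi.single i (EuclideanSpace.single c (1 : ℝ)))‖ ^ 2 +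
            ‖fderiv ℝ (fun Y => conj (m Y) * Ψ Y) X (Pi.single i (EuclideanSpace.single c (1 : ℝ)))‖ ^ 2) := by
        rw [← Finset.sum_add_distrib]
        exact Finset.sum_congr rfl fun i _ => (Finset.sum_add_distrib).symm
    _ = ∑ i : Fin M, ∑ c : Fin 3,
          (2 * (‖fderiv ℝ m X (Pi.single i (EuclideanSpace.single c (1 : ℝ)))‖ ^ 2 * ‖Ψ X‖ ^ 2) +
            2 * (conj (fderiv ℝ (fun Y => conj (m Y) * (m Y * Ψ Y)) X
                (Pi.single i (EuclideanSpace.single c (1 : ℝ)))) *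
              fderiv ℝ Ψ X (Pi.single i (EuclideanSpace.single c (1 : ℝ)))).re) :=
        Finset.sum_congr rfl fun i _ => Finset.sum_congr rfl fun c _ => key i c
    _ = _ := by
        rw [Finset.sum_mul, Finset.mul_sum, Finset.mul_sum, ← Finset.sum_add_distrib]
        refine Finset.sum_congr rfl fun i _ => ?_
        rw [Finset.sum_mul, Finset.mul_sum, Finset.mul_sum, ← Finset.sum_add_distrib]

/-! ## Integrated: kinetic, potential and mass parts -/

/-- The kinetic f-sum identity: `T(mΨ) + T(m̄Ψ) = 2∫|∇m|²|Ψ|² + 2∫ kinCross(m̄mΨ, Ψ)`. [folklore] -/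
theorem cellKineticEnergy_mul_add_conj_mul (hm : ContDiff ℝ 1 m) (hΨ : ContDiff ℝ 1 Ψ) (L : ℝ) :
    cellKineticEnergy L (fun Y => m Y * Ψ Y) + cellKineticEnergy L (fun Y => conj (m Y) * Ψ Y) =
      2 * (∫ X in cellN M L, kineticDensityReal m X * ‖Ψ X‖ ^ 2) +
        2 * ∫ X in cellN M L, kinCross (fun Y => conj (m Y) * (m Y * Ψ Y)) Ψ X := by
  have hmc : ContDiff ℝ 1 (fun Y => conj (m Y)) := Complex.conjCLE.contDiff.comp hm
  have h1 : Integrable (kineticDensityReal (fun Y => m Y * Ψ Y)) (volume.restrict (cellN M L)) :=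
    integrableOn_cellN (continuous_kineticDensityReal (hm.mul hΨ)) L
  have h2 : Integrable (kineticDensityReal (fun Y => conj (m Y) * Ψ Y)) (volume.restrict (cellN M L)) :=
    integrableOn_cellN (continuous_kineticDensityReal (hmc.mul hΨ)) L
  have h3 : Integrable (fun X => kineticDensityReal m X * ‖Ψ X‖ ^ 2) (volume.restrict (cellN M L)) :=
    integrableOn_cellN ((continuous_kineticDensityReal hm).mul (hΨ.continuous.norm.pow 2)) L
  have h4 : Integrable (kinCross (fun Y => conj (m Y) * (m Y * Ψ Y)) Ψ) (volume.restrict (cellN M L)) :=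
    integrableOn_cellN (continuous_kinCross (hmc.mul (hm.mul hΨ)) hΨ) L
  unfold cellKineticEnergy
  rw [← integral_add h1 h2, ← integral_const_mul, ← integral_const_mul,
    ← integral_add (h3.const_mul _) (h4.const_mul _)]
  refine integral_congr_ae (Eventually.of_forall fun X => ?_)
  exact kineticDensityReal_mul_add_conj_mul ((hm.differentiable one_ne_zero) X)
    ((hΨ.differentiable one_ne_zero) X)

/-- `∫|∇m|²|Ψ|² ≤ B‖Ψ‖²` when `|∇m|² ≤ B`. [folklore] -/
theorem integral_kineticDensityReal_mul_sq_le (hm : ContDiff ℝ 1 m) (hΨ : Continuous Ψ) {B : ℝ}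
    (hB : ∀ X, kineticDensityReal m X ≤ B) :
    (∫ X in cellN M L, kineticDensityReal m X * ‖Ψ X‖ ^ 2) ≤ B * (normSq L Ψ).toReal := by
  rw [toReal_normSq hΨ, ← integral_const_mul]
  refine integral_mono (integrableOn_cellN ((continuous_kineticDensityReal hm).mul (hΨ.norm.pow 2)) L)
    ((integrableOn_cellN (hΨ.norm.pow 2) L).const_mul B) fun X => ?_
  exact mul_le_mul_of_nonneg_right (hB X) (sq_nonneg _)

/-- `P_w(mΨ) = ∫ W Re(conj(m̄mΨ) Ψ)` (both are `∫ W|m|²|Ψ|²`), when `P_w(mΨ) < ∞`. [folklore] -/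
theorem toReal_potForm_mul {w : ℝ → ℝ≥0∞} (hw : Measurable w) (hm : Continuous m) (hΨ : Continuous Ψ)
    (hP : potForm w L (fun Y => m Y * Ψ Y) ≠ ⊤) :
    (potForm w L (fun Y => m Y * Ψ Y)).toReal =
      ∫ X in cellN M L, (periodicInteraction w L X).toReal * (conj (conj (m X) * (m X * Ψ X)) * Ψ X).re := by
  rw [← integral_potReal (h := fun Y => m Y * Ψ Y) hw (hm.mul hΨ) hP]
  refine integral_congr_ae (Eventually.of_forall fun X => ?_)
  simp only [norm_mul_sq_eq_re]

/-- `P_w(m̄Ψ) = ∫ W Re(conj(m̄mΨ) Ψ)`, when `P_w(m̄Ψ) < ∞`. [folklore] -/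
theorem toReal_potForm_conj_mul {w : ℝ → ℝ≥0∞} (hw : Measurable w) (hm : Continuous m) (hΨ : Continuous Ψ)
    (hP : potForm w L (fun Y => conj (m Y) * Ψ Y) ≠ ⊤) :
    (potForm w L (fun Y => conj (m Y) * Ψ Y)).toReal =
      ∫ X in cellN M L, (periodicInteraction w L X).toReal * (conj (conj (m X) * (m X * Ψ X)) * Ψ X).re := by
  rw [← integral_potReal (h := fun Y => conj (m Y) * Ψ Y) hw (by fun_prop) hP]
  refine integral_congr_ae (Eventually.of_forall fun X => ?_)
  simp only [norm_conj_mul_sq_eq_re]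

/-- `‖mΨ‖² = Re⟨m̄mΨ, Ψ⟩`. [folklore] -/
theorem toReal_normSq_mul (hm : Continuous m) (hΨ : Continuous Ψ) :
    (normSq L (fun Y => m Y * Ψ Y)).toReal = innerRe L (fun Y => conj (m Y) * (m Y * Ψ Y)) Ψ := by
  rw [toReal_normSq (h := fun Y => m Y * Ψ Y) (hm.mul hΨ), ← integral_re_conj_mul (by fun_prop) hΨ]
  refine integral_congr_ae (Eventually.of_forall fun X => ?_)
  simp only [norm_mul_sq_eq_re]

/-- `‖m̄Ψ‖² = Re⟨m̄mΨ, Ψ⟩`. [folklore] -/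
theorem toReal_normSq_conj_mul (hm : Continuous m) (hΨ : Continuous Ψ) :
    (normSq L (fun Y => conj (m Y) * Ψ Y)).toReal = innerRe L (fun Y => conj (m Y) * (m Y * Ψ Y)) Ψ := by
  rw [toReal_normSq (h := fun Y => conj (m Y) * Ψ Y) (by fun_prop), ← integral_re_conj_mul (by fun_prop) hΨ]
  refine integral_congr_ae (Eventually.of_forall fun X => ?_)
  simp only [norm_conj_mul_sq_eq_re]

/-! ## The f-sum form inequality -/

/-- **f-sum form inequality**: `Q_E(mΨ) + Q_E(m̄Ψ) ≤ 2B‖Ψ‖² + 2(Re B(m̄mΨ, Ψ) − E Re⟨m̄mΨ, Ψ⟩)` for every real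
`E`, `C¹` data with finite potential parts, `|∇m|² ≤ B` (an identity with `2∫|∇m|²|Ψ|²` in place of `2B‖Ψ‖²`).
[folklore] -/
theorem eform_mul_add_conj_mul_le (hL : 0 < L) {w : ℝ → ℝ≥0∞} (hw : Measurable w) (E : ℝ)
    (hm : ContDiff ℝ 1 m) (hΨ : ContDiff ℝ 1 Ψ) {B : ℝ} (hB : ∀ X, kineticDensityReal m X ≤ B)
    (hPΨ : potForm w L Ψ ≠ ⊤) (hP₁ : potForm w L (fun Y => m Y * Ψ Y) ≠ ⊤)
    (hP₂ : potForm w L (fun Y => conj (m Y) * Ψ Y) ≠ ⊤)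
    (hP₃ : potForm w L (fun Y => conj (m Y) * (m Y * Ψ Y)) ≠ ⊤) :
    eform w L E (fun Y => m Y * Ψ Y) + eform w L E (fun Y => conj (m Y) * Ψ Y) ≤
      2 * B * (normSq L Ψ).toReal +
        2 * (formRe w L (fun Y => conj (m Y) * (m Y * Ψ Y)) Ψ -
          E * innerRe L (fun Y => conj (m Y) * (m Y * Ψ Y)) Ψ) := by
  have _ := hL
  have hmc : ContDiff ℝ 1 (fun Y => conj (m Y)) := Complex.conjCLE.contDiff.comp hm
  unfold eform
  rw [toReal_qform w L (hm.mul hΨ) hP₁, toReal_qform w L (hmc.mul hΨ) hP₂,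
    formRe_eq_integral_add hw (hmc.mul (hm.mul hΨ)) hΨ hP₃ hPΨ,
    toReal_potForm_mul hw hm.continuous hΨ.continuous hP₁,
    toReal_potForm_conj_mul hw hm.continuous hΨ.continuous hP₂,
    toReal_normSq_mul hm.continuous hΨ.continuous, toReal_normSq_conj_mul hm.continuous hΨ.continuous]
  have hkin := cellKineticEnergy_mul_add_conj_mul hm hΨ L
  have hle := integral_kineticDensityReal_mul_sq_le (L := L) hm hΨ.continuous hB
  nlinarith [hkin, hle]

/-- **The f-sum bound for near-minimisers**: if `𝓔[Ψ] ≤ E₀‖Ψ‖² + δ` then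
`Q_{E₀}(mΨ) ≤ 2B‖Ψ‖² + 2√δ √𝓔[m̄mΨ]` (drop `Q_{E₀}(m̄Ψ) ≥ 0`, bound the bracket by `WF.abs_formRe_sub_le`).
[folklore] -/
theorem eform_mul_le_of_nearMin (hL : 0 < L) {w : ℝ → ℝ≥0∞} (hw : Measurable w)
    (hm : ContDiff ℝ 1 m) (hΨ : IsCore L Ψ) (h₂ : IsCore L (fun Y => conj (m Y) * Ψ Y))
    (h₃ : IsCore L (fun Y => conj (m Y) * (m Y * Ψ Y))) {B : ℝ} (hB : ∀ X, kineticDensityReal m X ≤ B)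
    (hqΨ : qform w L Ψ ≠ ⊤) (hq₁ : qform w L (fun Y => m Y * Ψ Y) ≠ ⊤)
    (hq₂ : qform w L (fun Y => conj (m Y) * Ψ Y) ≠ ⊤) (hq₃ : qform w L (fun Y => conj (m Y) * (m Y * Ψ Y)) ≠ ⊤)
    (hE : periodicGroundStateEnergy w M L ≠ ⊤) {δ : ℝ} (hδ : 0 ≤ δ)
    (hnear : (qform w L Ψ).toReal ≤ (periodicGroundStateEnergy w M L).toReal * (normSq L Ψ).toReal + δ) :
    eform w L (periodicGroundStateEnergy w M L).toReal (fun Y => m Y * Ψ Y) ≤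
      2 * B * (normSq L Ψ).toReal +
        2 * (Real.sqrt δ * Real.sqrt ((qform w L (fun Y => conj (m Y) * (m Y * Ψ Y))).toReal)) := by
  have h1 := eform_mul_add_conj_mul_le hL hw (periodicGroundStateEnergy w M L).toReal hm hΨ.contDiff hB
    (ne_top_of_le_ne_top hqΨ (potForm_le_qform' w L _)) (ne_top_of_le_ne_top hq₁ (potForm_le_qform' w L _))
    (ne_top_of_le_ne_top hq₂ (potForm_le_qform' w L _)) (ne_top_of_le_ne_top hq₃ (potForm_le_qform' w L _))
  have h2 : 0 ≤ eform w L (periodicGroundStateEnergy w M L).toReal (fun Y => conj (m Y) * Ψ Y) :=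
    stub_eformNonneg w h₂ hq₂
  have h3 := abs_formRe_sub_le_left hL hw hΨ h₃ hqΨ hq₃ hE hδ hnear
  have h4 := le_abs_self (formRe w L (fun Y => conj (m Y) * (m Y * Ψ Y)) Ψ -
    (periodicGroundStateEnergy w M L).toReal * innerRe L (fun Y => conj (m Y) * (m Y * Ψ Y)) Ψ)
  linarith

/-! ## Uniform bounds for the two auxiliary forms of the block -/

/-- **Uniform form bound for `conj(G_k)·U_kΨ`**: there is `C < ∞` (depending on `n, L, k, w` only) with
`𝓔_w[conj(G_k) U_kΨ] ≤ C·D` for every core `Ψ` with `𝓔_w[Ψ], ‖Ψ‖² ≤ D`. [folklore] -/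
theorem exists_bound_conj_densityWave_phaseUp (hL : 0 < L) {w : ℝ → ℝ≥0∞} (hw : Measurable w)
    (hint : (∫⁻ x : Space, w ‖x‖) ≠ ⊤) (k : Fin 3 → ℤ) :
    ∃ C : ℝ≥0∞, C ≠ ⊤ ∧ ∀ {Ψ : Config (n + 1) → ℂ}, IsCore L Ψ → ∀ {D : ℝ≥0∞}, qform w L Ψ ≤ D → normSq L Ψ ≤ D →
      qform w L (fun X => conj (∑ j, cellWave L k (X j)) * phaseUp L k Ψ X) ≤ C * D := by
  set CU : ℝ≥0∞ := 2 * ((n + 1 : ℝ≥0∞) * ((n + 1 : ℝ≥0∞) *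
      (1 + ENNReal.ofReal (‖latticeVec (2 * Real.pi / L) k‖ ^ 2 + n * (∫⁻ x : Space, w ‖x‖).toReal / L ^ 3)))) +
    2 * ((n + 1 : ℝ≥0∞) * ((n + 1 : ℝ≥0∞) *
      (1 + ENNReal.ofReal (‖latticeVec (2 * Real.pi / L) 0‖ ^ 2 + n * (∫⁻ x : Space, w ‖x‖).toReal / L ^ 3))))
    with hCU
  set CN : ℝ≥0∞ := 4 * ((n + 1 : ℝ≥0∞) * (n + 1 : ℝ≥0∞)) with hCN
  have hn1 : (n + 1 : ℝ≥0∞) ≠ ⊤ := by simp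
  have hCUtop : CU ≠ ⊤ := by
    simp only [hCU]
    refine ENNReal.add_ne_top.2 ⟨?_, ?_⟩ <;>
      exact ENNReal.mul_ne_top ENNReal.ofNat_ne_top (ENNReal.mul_ne_top hn1
        (ENNReal.mul_ne_top hn1 (ENNReal.add_ne_top.2 ⟨ENNReal.one_ne_top, ENNReal.ofReal_ne_top⟩)))
  have hCNtop : CN ≠ ⊤ := ENNReal.mul_ne_top ENNReal.ofNat_ne_top (ENNReal.mul_ne_top hn1 hn1)
  refine ⟨ENNReal.ofReal (2 * ((n + 1 : ℕ) : ℝ) ^ 2) * CU +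
    ENNReal.ofReal (2 * (((n + 1 : ℕ) : ℝ) * ‖waveVector L k‖ ^ 2)) * CN,
    ENNReal.add_ne_top.2 ⟨ENNReal.mul_ne_top ENNReal.ofReal_ne_top hCUtop,
      ENNReal.mul_ne_top ENNReal.ofReal_ne_top hCNtop⟩, fun hΨ D hq hn => ?_⟩
  have hU := isCore_phaseUp hL k hΨ
  calc qform w L (fun X => conj (∑ j, cellWave L k (X j)) * phaseUp L k _ X)
      ≤ ENNReal.ofReal (2 * ((n + 1 : ℕ) : ℝ) ^ 2) * qform w L (phaseUp L k _) +
          ENNReal.ofReal (2 * (((n + 1 : ℕ) : ℝ) * ‖waveVector L k‖ ^ 2)) * normSq L (phaseUp L k _) :=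
        qform_conj_densityWave_mul_le w L k (hU.contDiff.differentiable one_ne_zero)
    _ ≤ ENNReal.ofReal (2 * ((n + 1 : ℕ) : ℝ) ^ 2) * (CU * D) +
          ENNReal.ofReal (2 * (((n + 1 : ℕ) : ℝ) * ‖waveVector L k‖ ^ 2)) * (CN * D) :=
        add_le_add (mul_le_mul_right (qform_phaseUp_le hL hw hint k hΨ hq hn) _)
          (mul_le_mul_right (normSq_phaseUp_le hL k hΨ hn) _)
    _ = _ := by ring

/-- **Uniform form bound for `|G_k|²Ψ = conj(G_k)·(G_k·Ψ)`**: there is `C < ∞` (depending on `M, L, k` only)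
with `𝓔_w[|G_k|²Ψ] ≤ C·D` for every differentiable `Ψ` with `𝓔_w[Ψ], ‖Ψ‖² ≤ D`. [folklore] -/
theorem exists_bound_densityWave_sq (w : ℝ → ℝ≥0∞) (L : ℝ) (k : Fin 3 → ℤ) :
    ∃ C : ℝ≥0∞, C ≠ ⊤ ∧ ∀ {Ψ : Config M → ℂ}, Differentiable ℝ Ψ → ∀ {D : ℝ≥0∞}, qform w L Ψ ≤ D →
      normSq L Ψ ≤ D →
        qform w L (fun X => conj (∑ j, cellWave L k (X j)) * ((∑ j, cellWave L k (X j)) * Ψ X)) ≤ C * D := by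
  refine ⟨ENNReal.ofReal (2 * (M : ℝ) ^ 2) * (ENNReal.ofReal (2 * (M : ℝ) ^ 2) +
      ENNReal.ofReal (2 * (M * ‖waveVector L k‖ ^ 2))) +
    ENNReal.ofReal (2 * (M * ‖waveVector L k‖ ^ 2)) * ENNReal.ofReal ((M : ℝ) ^ 2),
    ENNReal.add_ne_top.2 ⟨ENNReal.mul_ne_top ENNReal.ofReal_ne_top
      (ENNReal.add_ne_top.2 ⟨ENNReal.ofReal_ne_top, ENNReal.ofReal_ne_top⟩),
      ENNReal.mul_ne_top ENNReal.ofReal_ne_top ENNReal.ofReal_ne_top⟩, fun hΨ D hq hn => ?_⟩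
  have hG : Differentiable ℝ (fun X : Config M => (∑ j, cellWave L k (X j)) * _) :=
    (differentiable_densityWave L k).mul hΨ
  calc qform w L (fun X => conj (∑ j, cellWave L k (X j)) * ((∑ j, cellWave L k (X j)) * _))
      ≤ ENNReal.ofReal (2 * (M : ℝ) ^ 2) * qform w L (fun X => (∑ j, cellWave L k (X j)) * _) +
          ENNReal.ofReal (2 * (M * ‖waveVector L k‖ ^ 2)) * normSq L (fun X => (∑ j, cellWave L k (X j)) * _) :=
        qform_conj_densityWave_mul_le w L k hG
    _ ≤ ENNReal.ofReal (2 * (M : ℝ) ^ 2) * (ENNReal.ofReal (2 * (M : ℝ) ^ 2) * D +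
          ENNReal.ofReal (2 * (M * ‖waveVector L k‖ ^ 2)) * D) +
          ENNReal.ofReal (2 * (M * ‖waveVector L k‖ ^ 2)) * (ENNReal.ofReal ((M : ℝ) ^ 2) * D) := by
        gcongr
        · exact (qform_densityWave_mul_le w L k hΨ).trans (add_le_add (mul_le_mul_right hq _) (mul_le_mul_right hn _))
        · exact (normSq_densityWave_mul_le L k _).trans (mul_le_mul_right hn _)
    _ = _ := by ring

/-- With no particle the phase quadrature vanishes: `U_k = 0` on `Config 0`. [folklore] -/
theorem phaseUp_zero (L : ℝ) (k : Fin 3 → ℤ) (Ψ : Config 0 → ℂ) : phaseUp L k Ψ = 0 := by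
  funext X
  simp [phaseUp, transfer]

/-- `Re⟨0, g⟩ = 0`. [folklore] -/
theorem innerRe_zero_left (L : ℝ) (g : Config M → ℂ) : innerRe L 0 g = 0 := by
  simp [innerRe]

/-- **(II) The f-sum bound for the density wave**: for a near-minimiser `Ψ` (`𝓔[Ψ] ≤ E₀‖Ψ‖² + η`),
`Q_{E₀}(G_kΨ) ≤ 2M‖k̃‖²‖Ψ‖² + 2√η √𝓔[|G_k|²Ψ]`. [folklore] -/
theorem eform_densityWave_mul_le_of_nearMin (hL : 0 < L) {w : ℝ → ℝ≥0∞} (hw : Measurable w)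
    (hE : periodicGroundStateEnergy w M L ≠ ⊤) (k : Fin 3 → ℤ) {Ψ : Config M → ℂ} (hΨ : IsCore L Ψ)
    (hq : qform w L Ψ ≠ ⊤) {η : ℝ} (hη : 0 ≤ η)
    (hnear : (qform w L Ψ).toReal ≤ (periodicGroundStateEnergy w M L).toReal * (normSq L Ψ).toReal + η) :
    eform w L (periodicGroundStateEnergy w M L).toReal (fun X => (∑ j, cellWave L k (X j)) * Ψ X) ≤
      2 * ((M : ℝ) * ‖waveVector L k‖ ^ 2) * (normSq L Ψ).toReal +
        2 * (Real.sqrt η * Real.sqrt ((qform w L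
          (fun X => conj (∑ j, cellWave L k (X j)) * ((∑ j, cellWave L k (X j)) * Ψ X))).toReal)) := by
  have hd := hΨ.contDiff.differentiable one_ne_zero
  have hGd : Differentiable ℝ (fun X : Config M => (∑ j, cellWave L k (X j)) * Ψ X) :=
    (differentiable_densityWave L k).mul hd
  exact eform_mul_le_of_nearMin hL hw (contDiff_densityWave L k) hΨ (isCore_conj_densityWave_mul hL k hΨ)
    (isCore_conj_densityWave_mul hL k (isCore_densityWave_mul hL k hΨ))
    (fun X => (kineticDensityReal_densityWave L k X).le) hq
    (qform_densityWave_mul_ne_top w L k hd hq) (qform_conj_densityWave_mul_ne_top w L k hd hq)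
    (qform_conj_densityWave_mul_ne_top w L k hGd (qform_densityWave_mul_ne_top w L k hd hq)) hE hη hnear

/-- **(I) The cone step**: for a near-minimiser `Ψ` on `n + 1` particles,
`|Re⟨U_kΨ, W_kΨ⟩| ≤ √(Q_{E₀}(U_kΨ) Q_{E₀}(G_kΨ)) + √η √𝓔[conj(G_k) U_kΨ]`. [folklore] -/
theorem abs_innerRe_phaseUp_kinCommutator_le (hL : 0 < L) {w : ℝ → ℝ≥0∞} (hw : Measurable w)
    (hint : (∫⁻ x : Space, w ‖x‖) ≠ ⊤) (hE : periodicGroundStateEnergy w (n + 1) L ≠ ⊤) (k : Fin 3 → ℤ)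
    {Ψ : Config (n + 1) → ℂ} (hΨ : IsCore L Ψ) (hq : qform w L Ψ ≠ ⊤) {η : ℝ} (hη : 0 ≤ η)
    (hnear : (qform w L Ψ).toReal ≤ (periodicGroundStateEnergy w (n + 1) L).toReal * (normSq L Ψ).toReal + η) :
    |innerRe L (phaseUp L k Ψ) (kinCommutator L k Ψ)| ≤
      Real.sqrt (eform w L (periodicGroundStateEnergy w (n + 1) L).toReal (phaseUp L k Ψ) *
          eform w L (periodicGroundStateEnergy w (n + 1) L).toReal (fun X => (∑ j, cellWave L k (X j)) * Ψ X)) +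
        Real.sqrt η * Real.sqrt ((qform w L (fun X => conj (∑ j, cellWave L k (X j)) * phaseUp L k Ψ X)).toReal) := by
  have hU := isCore_phaseUp hL k hΨ
  have hUq := qform_phaseUp_ne_top hL hw hint k hΨ hq
  have hUd := hU.contDiff.differentiable one_ne_zero
  have hd := hΨ.contDiff.differentiable one_ne_zero
  have hG1 := isCore_densityWave_mul hL k hΨ
  have hG1q := qform_densityWave_mul_ne_top w L k hd hq
  have hG2 := isCore_conj_densityWave_mul hL k hU
  have hG2q := qform_conj_densityWave_mul_ne_top w L k hUd hUq
  have hb := abs_formRe_sub_le_sqrt hL hw hU hG1 hUq hG1q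
  have hp := abs_formRe_sub_le_left hL hw hΨ hG2 hq hG2q hE hη hnear
  have hdd := formRe_densityWave_mul hL hw k hU.contDiff hΨ.contDiff hU.periodic hΨ.periodic
    (ne_top_of_le_ne_top hUq (potForm_le_qform' w L _)) (ne_top_of_le_ne_top hq (potForm_le_qform' w L _))
    (ne_top_of_le_ne_top hG1q (potForm_le_qform' w L _)) (ne_top_of_le_ne_top hG2q (potForm_le_qform' w L _))
  have hi := innerRe_mul_right L (phaseUp L k Ψ) Ψ (fun X => ∑ j, cellWave L k (X j))
  have heq : innerRe L (phaseUp L k Ψ) (kinCommutator L k Ψ) =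
      (formRe w L (phaseUp L k Ψ) (fun X => (∑ j, cellWave L k (X j)) * Ψ X) -
          (periodicGroundStateEnergy w (n + 1) L).toReal *
            innerRe L (phaseUp L k Ψ) (fun X => (∑ j, cellWave L k (X j)) * Ψ X)) -
        (formRe w L (fun X => conj (∑ j, cellWave L k (X j)) * phaseUp L k Ψ X) Ψ -
          (periodicGroundStateEnergy w (n + 1) L).toReal *
            innerRe L (fun X => conj (∑ j, cellWave L k (X j)) * phaseUp L k Ψ X) Ψ) := by
    rw [hi]
    linarith
  rw [heq]
  exact (abs_sub _ _).trans (add_le_add hb hp)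

/-- **S2 — the phase cone block** (registered stub `stub_phaseConeBlock` of line `fsum-phase-pencil`):
`|Re⟨U_kΨ, W_kΨ⟩| ≤ √(Q_{E₀}(U_kΨ)·(2N‖k̃‖² + ε)) + ε` for `δ`-near-minimisers, `δ = δ(w, N, L, k, ε) > 0`.
[folklore] -/
theorem stub_phaseConeBlock : PhaseConeBlock := by
  intro w hw hint N L hL hE k _hk ε hε
  cases N with
  | zero =>
    exact ⟨1, one_pos, fun Ψ _ => by
      rw [phaseUp_zero, innerRe_zero_left, abs_zero]
      positivity⟩
  | succ n =>
    obtain ⟨C₁', hC₁'top, hC₁'⟩ := exists_bound_densityWave_sq (M := n + 1) w L k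
    obtain ⟨C₂', hC₂'top, hC₂'⟩ := exists_bound_conj_densityWave_phaseUp (n := n) hL hw.1 hint k
    have hDtop : periodicGroundStateEnergy w (n + 1) L + 1 ≠ ⊤ := ENNReal.add_ne_top.2 ⟨hE, ENNReal.one_ne_top⟩
    have h1D : (1 : ℝ≥0∞) ≤ periodicGroundStateEnergy w (n + 1) L + 1 := le_add_self
    obtain ⟨η, hη0, hη1, hs₁, hs₂⟩ := exists_slack_sqrt
      (Real.sqrt_nonneg ((C₁' * (periodicGroundStateEnergy w (n + 1) L + 1)).toReal))
      (Real.sqrt_nonneg ((C₂' * (periodicGroundStateEnergy w (n + 1) L + 1)).toReal)) hε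
    refine ⟨ENNReal.ofReal η, ENNReal.ofReal_pos.2 hη0, fun Ψ hΨ => ?_⟩
    have hcore : IsCore L Ψ.ψ := isCore_trialState Ψ
    have hn1 : normSq L Ψ.ψ = 1 := Ψ.norm_eq
    have hq : qform w L Ψ.ψ ≤ periodicGroundStateEnergy w (n + 1) L + ENNReal.ofReal η := hΨ
    have hqD : qform w L Ψ.ψ ≤ periodicGroundStateEnergy w (n + 1) L + 1 :=
      hq.trans (add_le_add le_rfl (ENNReal.ofReal_le_one.2 hη1))
    have hnD : normSq L Ψ.ψ ≤ periodicGroundStateEnergy w (n + 1) L + 1 := hn1.le.trans h1D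
    have hqtop : qform w L Ψ.ψ ≠ ⊤ := ne_top_of_le_ne_top hDtop hqD
    have hnear : (qform w L Ψ.ψ).toReal ≤
        (periodicGroundStateEnergy w (n + 1) L).toReal * (normSq L Ψ.ψ).toReal + η := by
      rw [hn1, ENNReal.toReal_one, mul_one, ← ENNReal.toReal_ofReal hη0.le,
        ← ENNReal.toReal_add hE ENNReal.ofReal_ne_top]
      exact ENNReal.toReal_mono (ENNReal.add_ne_top.2 ⟨hE, ENNReal.ofReal_ne_top⟩) hq
    have hI := abs_innerRe_phaseUp_kinCommutator_le hL hw.1 hint hE k hcore hqtop hη0.le hnear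
    have hII := eform_densityWave_mul_le_of_nearMin hL hw.1 hE k hcore hqtop hη0.le hnear
    rw [hn1, ENNReal.toReal_one, mul_one] at hII
    have hII' : eform w L (periodicGroundStateEnergy w (n + 1) L).toReal
        (fun X => (∑ j, cellWave L k (X j)) * Ψ.ψ X) ≤
        2 * (((n + 1 : ℕ)) : ℝ) * ‖waveVector L k‖ ^ 2 + 2 * Real.sqrt η * Real.sqrt ((qform w L
          (fun X => conj (∑ j, cellWave L k (X j)) * ((∑ j, cellWave L k (X j)) * Ψ.ψ X))).toReal) := by
      linarith
    have hc₁ : Real.sqrt ((qform w L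
          (fun X => conj (∑ j, cellWave L k (X j)) * ((∑ j, cellWave L k (X j)) * Ψ.ψ X))).toReal) ≤
        Real.sqrt ((C₁' * (periodicGroundStateEnergy w (n + 1) L + 1)).toReal) :=
      Real.sqrt_le_sqrt (ENNReal.toReal_mono (ENNReal.mul_ne_top hC₁'top hDtop)
        (hC₁' (hcore.contDiff.differentiable one_ne_zero) hqD hnD))
    have hc₂ : Real.sqrt ((qform w L (fun X => conj (∑ j, cellWave L k (X j)) * phaseUp L k Ψ.ψ X)).toReal) ≤
        Real.sqrt ((C₂' * (periodicGroundStateEnergy w (n + 1) L + 1)).toReal) :=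
      Real.sqrt_le_sqrt (ENNReal.toReal_mono (ENNReal.mul_ne_top hC₂'top hDtop) (hC₂' hcore hqD hnD))
    have hQU : 0 ≤ eform w L (periodicGroundStateEnergy w (n + 1) L).toReal (phaseUp L k Ψ.ψ) :=
      stub_eformNonneg w (isCore_phaseUp hL k hcore) (qform_phaseUp_ne_top hL hw.1 hint k hcore hqtop)
    exact cone_block_algebra hQU hη0.le hI hII' hc₁ hc₂ hs₁ hs₂

end Summit.AtomisticToContinuum.BoseEinsteinCondensation.Cruxes.PeriodicIRBound.FsumPhasePencil

end
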